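import Summits.AtomisticToContinuum.HydrodynamicLimit.Theses.StiffCollisionalRelaxation
import Summits.AtomisticToContinuum.HydrodynamicLimit.Theses.CollisionIsometryCLT

/-!
# `AprioriBounds` (stmt-AtomisticToContinuum-14827) is the per-profile corollary of `AprioriBoundsInBand` (stmt-17749)

The route `StiffCollisionalRelaxation` (rev 5) promoted the PROFILE-UNIFORM a-priori statement
`AprioriBoundsInBand` (item 17749: `∃ η₁ > 0 ∀ profiles ∃ σ₀ …`) to its rank-4 crux and kept
`AprioriBounds` (item 14827: `∀ profiles ∃ σ₀ ∃ η₁ …`, = `CollisionIsometryCLT.AprioriBoundsPreShock`,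
one `Prop`) as a support, recording in the route docstring that the latter is the former's per-profile
corollary (`aprioriBounds_of_inBand` in the planner's sketch, never landed under `Theorems/`).  This file
lands that link, so that a proof of 17749 closes 14827 (both decls) mechanically: the two statements have
byte-identical bodies after the quantifier prefix, and moving `∃ η₁` inside `∀ profiles ∃ σ₀` is pure
logic.  The converse (14827 → 17749) is a genuine quantifier swap and is NOT claimed.

Helper for the line `fibre-deficit-transfer` on the crux stmt-AtomisticToContinuum-14827 (lead c8, cycle 3);
no new definitions, no named facts.
-/

namespace Summit.AtomisticToContinuum.HydrodynamicLimit.Theorems.FibreDeficitTransfer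

/-- **14827 ⇐ 17749.**  The profile-uniform a-priori bounds `StiffCollisionalRelaxation.AprioriBoundsInBand`
(`∃ η₁ > 0` before the profiles) imply the per-profile a-priori bounds
`StiffCollisionalRelaxation.AprioriBounds` (`∃ η₁ > 0` after `∃ σ₀`): instantiate the uniform threshold.
Pure quantifier bookkeeping; the bodies (prefix `IsHardSphereEulerSolution` + `TendstoHydroFieldsAt … 0` +
dilute chamber, components (i) and (ii)) are identical. -/
theorem aprioriBounds_of_inBand : Summit.AtomisticToContinuum.HydrodynamicLimit.Theses.StiffCollisionalRelaxation.AprioriBoundsInBand → Summit.AtomisticToContinuum.HydrodynamicLimit.Theses.StiffCollisionalRelaxation.AprioriBounds := by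
  rintro ⟨η₁, hη₁, H⟩
  intro a₀ θ₀ u₀ ha hθ hu ha0 hθ0
  obtain ⟨σ₀, hσ₀, H'⟩ := H a₀ θ₀ u₀ ha hθ hu ha0 hθ0
  exact ⟨σ₀, hσ₀, η₁, hη₁, H'⟩

/-- **`CollisionIsometryCLT.AprioriBoundsPreShock` ⇐ 17749.**  The same link for the `CollisionIsometryCLT`
copy of the crux (the two route decls are one `Prop`). -/
theorem aprioriBoundsPreShock_of_inBand : Summit.AtomisticToContinuum.HydrodynamicLimit.Theses.StiffCollisionalRelaxation.AprioriBoundsInBand → Summit.AtomisticToContinuum.HydrodynamicLimit.Theses.CollisionIsometryCLT.AprioriBoundsPreShock :=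
  fun h => aprioriBounds_of_inBand h

end Summit.AtomisticToContinuum.HydrodynamicLimit.Theorems.FibreDeficitTransfer
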